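import Summits.CriticalPhenomena.PercolationContinuityZ3.Theorems.PercBurnResprinkleUniformDiminishmentToolkit

/-!
# Uniform diminishment on `ℤ³` (2/8): straight moves in boxy sets; the diminished model

Helper file for item `stmt-CriticalPhenomena-7206` (`PercBurnResprinkle.UniformDiminishment`, the quenched,
uniform Aizenman–Grimmett diminishment on `ℤ³`), landed with `--supports stmt-CriticalPhenomena-7206`.
The proof runs the in-tree Aizenman–Grimmett engine (`Literature.Probability.Percolation.AGLine`, after
Martineau–Severo 2019 §6) for the two-parameter model "edges open with probability `p`, points of the
thinned deleted set restored with probability `s`"; no definitions are introduced — the available-edge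
map `av` and the exit event `A` enter through characterising hypotheses (`hav`, `hA`).

Contents: a "boxy" set (closed under taking sites coordinatewise between two of its points) induces a
connected subgraph of `ℤ³` (`reachable_siteOpenGraph_of_boxy`); boxes, slabs, hyperplanes and their
intersections are boxy. Then the model: available edges are monotone, the exit event
`A = {the available cluster of o leaves o + box r}` is increasing and determined by the finite window
`E(o + box(r+1)) ⊔ (o + box(r+1))` (`determinedBy_event`).
-/

namespace Summit.CriticalPhenomena.PercolationContinuityZ3.Theorems

open Literature.Probability.Percolation Literature.Probability.LatticeModels

namespace UnifDim

/-! ### Straight moves inside boxy sets -/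

/-- Moving `n` unit steps along the axis `i` inside `S`: if all the sites `u + k eᵢ`, `k ≤ n`, lie in
`S` then `u` and `u + n eᵢ` are joined in the subgraph of `ℤ³` induced on `S`. -/
theorem reachable_add_single_nat {S : Set (Site 3)} (i : Fin 3) (u : Site 3) (n : ℕ)
    (h : ∀ k : ℕ, k ≤ n → u + Pi.single i (k : ℤ) ∈ S) :
    (siteOpenGraph (zdGraph 3) S).Reachable u (u + Pi.single i (n : ℤ)) := by
  induction n with
  | zero => simp
  | succ n ih =>
    have h1 := ih fun k hk => h k (by omega)
    refine h1.trans (SimpleGraph.Adj.reachable ?_)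
    rw [siteOpenGraph_adj]
    refine ⟨?_, h n (by omega), h (n + 1) le_rfl⟩
    have : u + Pi.single i ((n + 1 : ℕ) : ℤ) = (u + Pi.single i (n : ℤ)) + Pi.single i 1 := by
      rw [add_assoc, ← Pi.single_add]; push_cast; rfl
    rw [this]
    exact adj_add_single _ i

/-- **One coordinate at a time.** In a boxy set `S` (closed under taking sites coordinatewise between
two of its points), two points differing in one coordinate only are joined inside `S`. -/
theorem reachable_of_boxy_single {S : Set (Site 3)}
    (hS : ∀ u ∈ S, ∀ w ∈ S, ∀ v : Site 3, (∀ i, v i ∈ Set.uIcc (u i) (w i)) → v ∈ S)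
    (i : Fin 3) {u w : Site 3} (hu : u ∈ S) (hw : w ∈ S) (huw : ∀ j, j ≠ i → w j = u j) :
    (siteOpenGraph (zdGraph 3) S).Reachable u w := by
  -- reduce to `u i ≤ w i`
  wlog hle : u i ≤ w i generalizing u w
  · exact (this hw hu (fun j hj => (huw j hj).symm) (le_of_not_ge hle)).symm
  obtain ⟨n, hn⟩ : ∃ n : ℕ, w i = u i + n := ⟨(w i - u i).toNat, by rw [Int.toNat_of_nonneg (by omega)]; ring⟩
  have hw_eq : w = u + Pi.single i (n : ℤ) := by
    funext j
    by_cases hj : j = i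
    · subst hj; rw [Pi.add_apply, Pi.single_eq_same, hn]
    · rw [Pi.add_apply, Pi.single_eq_of_ne hj, add_zero, huw j hj]
  rw [hw_eq]
  refine reachable_add_single_nat i u n fun k hk => hS u hu w hw _ fun j => ?_
  rw [Set.mem_uIcc]
  by_cases hj : j = i
  · subst hj
    rw [Pi.add_apply, Pi.single_eq_same, hn]
    left; constructor <;> omega
  · rw [Pi.add_apply, Pi.single_eq_of_ne hj, add_zero, huw j hj]
    left; exact ⟨le_rfl, le_rfl⟩

/-- **Boxy sets are connected**: any two points of a boxy set `S ⊆ ℤ³` are joined by a lattice path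
inside `S` (change the coordinates `0, 1, 2` in turn; the corner points lie between the endpoints). -/
theorem reachable_siteOpenGraph_of_boxy {S : Set (Site 3)}
    (hS : ∀ u ∈ S, ∀ w ∈ S, ∀ v : Site 3, (∀ i, v i ∈ Set.uIcc (u i) (w i)) → v ∈ S)
    {u w : Site 3} (hu : u ∈ S) (hw : w ∈ S) : (siteOpenGraph (zdGraph 3) S).Reachable u w := by
  -- corner points
  set u₁ : Site 3 := Function.update u 0 (w 0) with hu₁
  set u₂ : Site 3 := Function.update u₁ 1 (w 1) with hu₂
  have between₁ : ∀ i, u₁ i ∈ Set.uIcc (u i) (w i) := by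
    intro i
    by_cases hi : i = 0
    · subst hi; rw [hu₁, Function.update_self]; exact Set.right_mem_uIcc
    · rw [hu₁, Function.update_of_ne hi]; exact Set.left_mem_uIcc
  have between₂ : ∀ i, u₂ i ∈ Set.uIcc (u i) (w i) := by
    intro i
    by_cases hi : i = 1
    · subst hi; rw [hu₂, Function.update_self]; exact Set.right_mem_uIcc
    · rw [hu₂, Function.update_of_ne hi]; exact between₁ i
  have hu₁S : u₁ ∈ S := hS u hu w hw u₁ between₁
  have hu₂S : u₂ ∈ S := hS u hu w hw u₂ between₂
  have step₁ : (siteOpenGraph (zdGraph 3) S).Reachable u u₁ :=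
    reachable_of_boxy_single hS 0 hu hu₁S fun j hj => by rw [hu₁, Function.update_of_ne hj]
  have step₂ : (siteOpenGraph (zdGraph 3) S).Reachable u₁ u₂ :=
    reachable_of_boxy_single hS 1 hu₁S hu₂S fun j hj => by rw [hu₂, Function.update_of_ne hj]
  have step₃ : (siteOpenGraph (zdGraph 3) S).Reachable u₂ w := by
    refine reachable_of_boxy_single hS 2 hu₂S hw fun j hj => ?_
    -- `j ∈ {0, 1}`
    have hj' : j = 0 ∨ j = 1 := by
      rcases j with ⟨j, hj3⟩
      simp only [Fin.ext_iff, Fin.val_zero, Fin.val_one, ne_eq, Fin.isValue] at hj ⊢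
      omega
    rcases hj' with rfl | rfl
    · rw [hu₂, Function.update_of_ne (by decide), hu₁, Function.update_self]
    · rw [hu₂, Function.update_self]
  exact step₁.trans (step₂.trans step₃)

/-! ### Boxy sets: the examples used by the surgery -/

/-- A translated sup-box is boxy. -/
theorem boxy_box (c : Site 3) (n : ℕ) :
    ∀ u ∈ {v : Site 3 | v - c ∈ box 3 n}, ∀ w ∈ {v : Site 3 | v - c ∈ box 3 n}, ∀ v : Site 3,
      (∀ i, v i ∈ Set.uIcc (u i) (w i)) → v ∈ {v : Site 3 | v - c ∈ box 3 n} := by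
  intro u hu w hw v hv
  simp only [Set.mem_setOf_eq, sub_mem_box_iff] at hu hw ⊢
  intro i
  have h1 := hu i; have h2 := hw i; have h3 := hv i
  rw [Set.mem_uIcc] at h3
  constructor <;> omega

/-- A coordinate slab `{v | v i ∈ [[p, q]]}` is boxy. -/
theorem boxy_slab (i : Fin 3) (p q : ℤ) :
    ∀ u ∈ {v : Site 3 | v i ∈ Set.uIcc p q}, ∀ w ∈ {v : Site 3 | v i ∈ Set.uIcc p q}, ∀ v : Site 3,
      (∀ i, v i ∈ Set.uIcc (u i) (w i)) → v ∈ {v : Site 3 | v i ∈ Set.uIcc p q} := by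
  intro u hu w hw v hv
  simp only [Set.mem_setOf_eq, Set.mem_uIcc] at hu hw ⊢
  have h3 := hv i
  rw [Set.mem_uIcc] at h3
  omega

/-- A coordinate hyperplane `{v | v i = c}` is boxy. -/
theorem boxy_hyperplane (i : Fin 3) (c : ℤ) :
    ∀ u ∈ {v : Site 3 | v i = c}, ∀ w ∈ {v : Site 3 | v i = c}, ∀ v : Site 3,
      (∀ i, v i ∈ Set.uIcc (u i) (w i)) → v ∈ {v : Site 3 | v i = c} := by
  intro u hu w hw v hv
  simp only [Set.mem_setOf_eq] at hu hw ⊢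
  have h3 := hv i
  rw [Set.mem_uIcc] at h3
  omega

/-- The intersection of two boxy sets is boxy. -/
theorem boxy_inter {S T : Set (Site 3)}
    (hS : ∀ u ∈ S, ∀ w ∈ S, ∀ v : Site 3, (∀ i, v i ∈ Set.uIcc (u i) (w i)) → v ∈ S)
    (hT : ∀ u ∈ T, ∀ w ∈ T, ∀ v : Site 3, (∀ i, v i ∈ Set.uIcc (u i) (w i)) → v ∈ T) :
    ∀ u ∈ S ∩ T, ∀ w ∈ S ∩ T, ∀ v : Site 3, (∀ i, v i ∈ Set.uIcc (u i) (w i)) → v ∈ S ∩ T :=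
  fun u hu w hw v hv => ⟨hS u hu.1 w hw.1 v hv, hT u hu.2 w hw.2 v hv⟩

/-- Monotonicity of reachability inside vertex sets. -/
theorem reachable_siteOpenGraph_mono {S T : Set (Site 3)} (h : S ⊆ T) {u w : Site 3}
    (huw : (siteOpenGraph (zdGraph 3) S).Reachable u w) : (siteOpenGraph (zdGraph 3) T).Reachable u w := by
  refine huw.mono ?_
  intro x y hxy
  rw [siteOpenGraph_adj] at hxy ⊢
  exact ⟨hxy.1, h hxy.2.1, h hxy.2.2⟩


/-! ### Edges of walks -/

section WalkEdges

variable {V : Type*} {G' : SimpleGraph V}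

/-- Every endpoint of an edge of a walk is a vertex of the walk. -/
theorem mem_support_of_mem_edges {u v : V} (w : G'.Walk u v) {f : Sym2 V} (hf : f ∈ w.edges)
    {y : V} (hy : y ∈ f) : y ∈ w.support := by
  induction f using Sym2.ind with
  | _ a b =>
    rcases Sym2.mem_iff.1 hy with rfl | rfl
    · exact w.fst_mem_support_of_mem_edges hf
    · exact w.snd_mem_support_of_mem_edges hf

/-- The edges of a walk in the open graph of `ω` belong to `ω`. -/
theorem mem_of_mem_edges_openGraph {ω : Set (Sym2 V)} {u v : V} (w : (openGraph ω).Walk u v)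
    {f : Sym2 V} (hf : f ∈ w.edges) : f ∈ ω := by
  have h := w.edges_subset_edgeSet hf
  rw [openGraph, SimpleGraph.edgeSet_fromEdgeSet] at h
  exact h.1

/-- Monotonicity of open-graph reachability in the configuration. -/
theorem reachable_openGraph_mono {ω ω' : Set (Sym2 V)} (h : ω ⊆ ω') {u v : V}
    (huv : (openGraph ω).Reachable u v) : (openGraph ω').Reachable u v :=
  huv.mono (SimpleGraph.fromEdgeSet_mono h)

end WalkEdges

/-! ### The diminished configuration: available edges and the exit event

Throughout, `av ξ` denotes the set of AVAILABLE edges of a joint configuration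
`ξ ⊆ E ⊔ V` (open edges `Sum.inl e ∈ ξ`, restored vertices `Sum.inr y ∈ ξ`) relative to a deleted set
`D`: an edge of `ℤ³` is available iff it is open and each of its endpoints lying in `D` is restored.
The event `A` is "the available cluster of `o` leaves the sup-box of radius `r` around `o`". Both are
passed through characterising hypotheses (`hav`, `hA`), so that no auxiliary definition is needed. -/

section Model

variable {D : Set (Site 3)} {av : Set (Sym2 (Site 3) ⊕ Site 3) → Set (Sym2 (Site 3))}
  {A : Set (Set (Sym2 (Site 3) ⊕ Site 3))} {o : Site 3} {r : ℕ}

/-- Available edges are edges of `ℤ³`. -/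
theorem av_subset_edgeSet
    (hav : ∀ ξ f, f ∈ av ξ ↔ Sum.inl f ∈ ξ ∧ f ∈ (zdGraph 3).edgeSet ∧ ∀ y ∈ f, y ∈ D → Sum.inr y ∈ ξ)
    (ξ : Set (Sym2 (Site 3) ⊕ Site 3)) : av ξ ⊆ (zdGraph 3).edgeSet :=
  fun f hf => ((hav ξ f).1 hf).2.1

/-- Availability is monotone in the joint configuration. -/
theorem av_mono
    (hav : ∀ ξ f, f ∈ av ξ ↔ Sum.inl f ∈ ξ ∧ f ∈ (zdGraph 3).edgeSet ∧ ∀ y ∈ f, y ∈ D → Sum.inr y ∈ ξ)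
    {ξ ξ' : Set (Sym2 (Site 3) ⊕ Site 3)} (h : ξ ⊆ ξ') : av ξ ⊆ av ξ' := by
  intro f hf
  rw [hav] at hf ⊢
  exact ⟨h hf.1, hf.2.1, fun y hy hyD => h (hf.2.2 y hy hyD)⟩

/-- The exit event is increasing. -/
theorem isUpperSet_event
    (hav : ∀ ξ f, f ∈ av ξ ↔ Sum.inl f ∈ ξ ∧ f ∈ (zdGraph 3).edgeSet ∧ ∀ y ∈ f, y ∈ D → Sum.inr y ∈ ξ)
    (hA : ∀ ξ, ξ ∈ A ↔ ∃ v, (openGraph (av ξ)).Reachable o v ∧ v - o ∉ box 3 r) : IsUpperSet A := by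
  intro ξ ξ' hle hξ
  rw [hA] at hξ ⊢
  obtain ⟨v, hv, hfar⟩ := hξ
  exact ⟨v, reachable_openGraph_mono (av_mono hav hle) hv, hfar⟩

/-- **Locality of the exit event.** `A` is determined by the window
`K = E(o + box(r+1)) ⊔ (o + box(r+1))`: stop an available path at its first exit from `o + box r`;
up to there it only uses edges with both endpoints in `o + box (r+1)` and marks of such vertices. -/
theorem determinedBy_event
    (hav : ∀ ξ f, f ∈ av ξ ↔ Sum.inl f ∈ ξ ∧ f ∈ (zdGraph 3).edgeSet ∧ ∀ y ∈ f, y ∈ D → Sum.inr y ∈ ξ)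
    (hA : ∀ ξ, ξ ∈ A ↔ ∃ v, (openGraph (av ξ)).Reachable o v ∧ v - o ∉ box 3 r) :
    DeterminedBy A ↑((edgesIn (zdGraph 3) ((box 3 (r + 1)).image (· + o))).disjSum
      ((box 3 (r + 1)).image (· + o))) := by
  classical
  set KV : Finset (Site 3) := (box 3 (r + 1)).image (· + o) with hKV
  set KE : Finset (Sym2 (Site 3)) := edgesIn (zdGraph 3) KV with hKE
  -- one direction suffices
  suffices key : ∀ ξ ξ' : Set (Sym2 (Site 3) ⊕ Site 3),
      ξ ∩ ↑(KE.disjSum KV) = ξ' ∩ ↑(KE.disjSum KV) → ξ ∈ A → ξ' ∈ A by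
    rw [determinedBy_iff]
    exact fun ξ ξ' h => ⟨key ξ ξ' h, key ξ' ξ h.symm⟩
  intro ξ ξ' hagree hξ
  have hmem : ∀ i ∈ (↑(KE.disjSum KV) : Set (Sym2 (Site 3) ⊕ Site 3)), i ∈ ξ → i ∈ ξ' := fun i hi hiξ =>
    ((Set.ext_iff.1 hagree i).1 ⟨hiξ, hi⟩).1
  rw [hA] at hξ ⊢
  obtain ⟨v, ⟨w⟩, hfar⟩ := hξ
  have ho : ¬ (o - o ∉ box 3 r) := fun h => h (by rw [sub_self]; exact zero_mem_box 3 r)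
  obtain ⟨a₀, a, w₁, hadj, w₂, -, hw₁, ha⟩ :=
    exists_first_entrance {z : Site 3 | z - o ∉ box 3 r} w ho hfar
  refine ⟨a, ?_, ha⟩
  -- the stopped walk `w₁ ++ (a₀ → a)`
  set w' : (openGraph (av ξ)).Walk o a := w₁.append (SimpleGraph.Walk.cons hadj SimpleGraph.Walk.nil)
    with hw'
  have hsupp : ∀ z ∈ w'.support, z ∈ KV := by
    intro z hz
    rw [hw', SimpleGraph.Walk.mem_support_append_iff, SimpleGraph.Walk.support_cons,
      SimpleGraph.Walk.support_nil, List.mem_cons, List.mem_singleton] at hz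
    rw [hKV, mem_image_add_box]
    rcases hz with hz | rfl | rfl
    · exact box_mono 3 (Nat.le_succ r) (not_not.1 (hw₁ z hz))
    · exact box_mono 3 (Nat.le_succ r) (not_not.1 (hw₁ _ w₁.end_mem_support))
    · have h0 : a₀ - o ∈ box 3 r := not_not.1 (hw₁ _ w₁.end_mem_support)
      have hG : (zdGraph 3).Adj a₀ z :=
        av_subset_edgeSet hav ξ ((openGraph_adj _ _ _).1 hadj).1
      exact sub_mem_box_succ_of_adj h0 hG
  refine reachable_openGraph_of_edges w' fun f hf => ?_
  have hfξ : f ∈ av ξ := mem_of_mem_edges_openGraph w' hf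
  rw [hav] at hfξ ⊢
  obtain ⟨hin, hE, hmarks⟩ := hfξ
  have hends : ∀ y ∈ f, y ∈ KV := fun y hy => hsupp y (mem_support_of_mem_edges w' hf hy)
  have hfKE : f ∈ KE := by
    rw [hKE, mem_edgesIn_iff]
    exact ⟨hE, hends⟩
  refine ⟨hmem _ (by simp [hfKE]) hin, hE, fun y hy hyD => hmem _ ?_ (hmarks y hy hyD)⟩
  simp [hends y hy]


/-- An available edge of `ξ ∪ {e}` other than `e` is available in `ξ ∖ {e}`. -/
theorem av_diff_of_ne
    (hav : ∀ ξ f, f ∈ av ξ ↔ Sum.inl f ∈ ξ ∧ f ∈ (zdGraph 3).edgeSet ∧ ∀ y ∈ f, y ∈ D → Sum.inr y ∈ ξ)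
    {ξ : Set (Sym2 (Site 3) ⊕ Site 3)} {e f : Sym2 (Site 3)} (hf : f ∈ av (insert (Sum.inl e) ξ))
    (hfe : f ≠ e) : f ∈ av (ξ \ {Sum.inl e}) := by
  rw [hav] at hf ⊢
  obtain ⟨hin, hE, hmarks⟩ := hf
  refine ⟨⟨?_, fun h => hfe (Sum.inl_injective h)⟩, hE, fun y hy hyD => ⟨?_, fun h => Sum.inr_ne_inl h⟩⟩
  · rcases hin with h | h
    · exact absurd (Sum.inl_injective h) hfe
    · exact h
  · rcases hmarks y hy hyD with h | h
    · exact absurd h Sum.inr_ne_inl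
    · exact h

end Model

end UnifDim

end Summit.CriticalPhenomena.PercolationContinuityZ3.Theorems
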